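import Summits.BirchSwinnertonDyer.Rank1Residual.Additive.ChiBranchLowerTransportPotMult
import HarnessLib

/-!
# The LOWER half at an additive prime, (G)-ordinary defect-2 locus (`I₀*`): END-TO-END forms
# branch input ⟹ Miller lower half (given the exact leading term), and NON-VACUITY of the binders
# (cell `b2b-bsdres`, team n1011, seat p07, row T-N10-low; sequel of `ChiBranchLowerTransport[PotMult].lean`)

HONEST FRAMING (cell `b2b-bsdres`, run/shared/lean/b2b/bsd-rank1-residual/, verbatim in every
file): the goal of the cell is to DELETE the COMBINATION-SHAPED residual classes of the
Birch–Swinnerton-Dyer formula for ALL analytic-rank `≤ 1` elliptic curves over `ℚ` — "full BSD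
formula for every rank `≤ 1` curve in class `C`" assembled STRICTLY from published theorems — so
that the rank-`≤ 1` remainder becomes exactly the CONSTRUCTION-SHAPED classes, which are TYPED
(missing-input `Prop`s), NOT attempted. This is not "finishing BSD". Team n1011 (RESIDUAL-MAP §I
N10 / N11; lead ruling R3-2, r2 ROUTE-2 II.4.4): prove what is provable now; shrink each hard class
to its core with data; no claim beyond stated classes. Research route on the CONSTRUCTION-SHAPED
item N10 (and N11's class-level LOWER clause on `SubGordTwo` at `p = 3`); both stay CONSTRUCTION;
nothing is booked; no label moves. Theorems only (no definition, no new named fact).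

* `ClassX4Gord.missingLowerBoundAt_rankZero_of_chiBranchLower[Odd]_of_exact` / `ClassX3Gord.…`
  (defect 2, `r_an = 0`): the branch-level typed LOWER input (`ChiBranchLowerLeadingTerm[Odd]At W p`,
  this seat) gives `Typed.MissingLowerBoundAt W p` GRANTED n1011-p18's typed exact leading term
  `ExactLeadingTermAt W p` (Delbourgo 1998 Prop. 4 with `H¹`-factor of `p`-part `1` on the (G)-cell:
  additive-p2's READING, `GordCycLeadingTerm.lean`; a typed input, not a fact) — chain: branch ⟹
  `CycLowerLeadingTermAt` (`…_iff_chiBranchLower[Odd]_of_typeGOrd_of_semistabilityIndex_eq_two`,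
  Birch + Pal) ⟹ `CycLeadingTermDvdAt` (principality) ⟹ Miller (p18's
  `ClassX4Gord.missingLowerBoundAt_rankZero_of_cycLeadingTermDvd_of_exact`).
* `exists_semistableTwistDatum_of_typeGOrd_of_semistabilityIndex_eq_two[_odd]`: NON-VACUITY — on
  every additive (G)-ordinary defect-2 pair the binder set of the ∀-typed branch inputs is inhabited
  (good ordinary minimal twist model `TypeGOrd.exists_goodOrd_model_twist_pStar`, additive-p2;
  newform + period ratio from `hmodD`; cyclotomic datum; dual datum), so neither
  `ChiBranchLowerLeadingTerm[Odd]At` nor `ChiBranchLowerDivisibility[Odd]At` is vacuously true there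
  (r2 ROUTE-2 II.4.4).

Not in print for any pair; labels UNCHANGED. References: Pal 2012 [Pal2012] Thm. 3.2; Delbourgo 1998
[Delbourgo1998] Prop. 4, Main Conjecture p. 151; Edixhoven 1991 [EdixhovenManin1991] §1.
-/

noncomputable section

open scoped Classical MatrixGroups ModularForm NumberField

open CongruenceSubgroup WeierstrassCurve NumberField Literature.NumberTheory.EllipticCurves
  Literature.NumberTheory.EllipticCurves.ModularForms
  Literature.NumberTheory.EllipticCurves.Rank1Residual
  Literature.NumberTheory.EllipticCurves.Rank1Residual.Typed
  IsDedekindDomain Rat.HeightOneSpectrum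

namespace Summit.BirchSwinnertonDyer.Rank1Residual.Additive

variable {W : WeierstrassCurve ℚ} [W.IsElliptic] [W.IsGloballyMinimal] {p : ℕ} [hp : Fact p.Prime]

/-! ### §1 End-to-end on the (G)-ordinary defect-2 rows, given the exact leading term -/

/-- **X4♯(G-ord) ∩ `I₀*`, `r_an = 0`, `p ≡ 1 (mod 4)`: `ChiBranchLowerLeadingTermAt W p` +
`ExactLeadingTermAt W p` ⟹ `Typed.MissingLowerBoundAt W p`** (Birch + Pal `hPal`, `hmodD`, GZK,
modularity). [cite: Pal2012, Thm. 3.2] [cite: Delbourgo1998, Prop. 4 (p. 144) (shape of the exact input)] -/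
theorem ClassX4Gord.missingLowerBoundAt_rankZero_of_chiBranchLower_of_exact
    (hPal : Pal2012.thm32_sqrt_mul_realPeriodRat_twist_eq_of_prime_one_mod_four)
    (hGZK : rank_eq_analyticRank_of_analyticRank_le_one) (hmod : hasEntireLFunction_rat)
    (hmodD : nonempty_modularParametrizationData)
    (hX : ClassX4Gord W p) (he : semistabilityIndex W p = 2) (hp4 : p % 4 = 1)
    (hr : W.analyticRank = 0) (hLow : ChiBranchLowerLeadingTermAt W p) (hEx : ExactLeadingTermAt W p) :
    MissingLowerBoundAt W p :=
  ClassX4Gord.missingLowerBoundAt_rankZero_of_cycLeadingTermDvd_of_exact hGZK hmod hX hr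
    (cycLeadingTermDvdAt_of_cycLowerLeadingTermAt W p
      ((cycLowerLeadingTermAt_iff_chiBranchLower_of_typeGOrd_of_semistabilityIndex_eq_two W p hPal
        hmod hmodD hp4 hX.addv.2 hX.typeGOrd he).mpr hLow)) hEx

/-- **X4♯(G-ord) ∩ `I₀*`, `r_an = 0`, `p ≡ 3 (mod 4)` (`p = 3` included):
`ChiBranchLowerLeadingTermOddAt W p` + `ExactLeadingTermAt W p` ⟹ `Typed.MissingLowerBoundAt W p`.**
[cite: Pal2012, Thm. 3.2] [cite: Delbourgo1998, Prop. 4 (p. 144) (shape of the exact input)] -/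
theorem ClassX4Gord.missingLowerBoundAt_rankZero_of_chiBranchLowerOdd_of_exact
    (hGZK : rank_eq_analyticRank_of_analyticRank_le_one) (hmod : hasEntireLFunction_rat)
    (hmodD : nonempty_modularParametrizationData)
    (hX : ClassX4Gord W p) (he : semistabilityIndex W p = 2) (hp4 : p % 4 = 3)
    (hr : W.analyticRank = 0) (hLow : ChiBranchLowerLeadingTermOddAt W p) (hEx : ExactLeadingTermAt W p) :
    MissingLowerBoundAt W p :=
  ClassX4Gord.missingLowerBoundAt_rankZero_of_cycLeadingTermDvd_of_exact hGZK hmod hX hr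
    (cycLeadingTermDvdAt_of_cycLowerLeadingTermAt W p
      ((cycLowerLeadingTermAt_iff_chiBranchLowerOdd_of_typeGOrd_of_semistabilityIndex_eq_two W p
        hmod hmodD hp4 hX.addv.2 hX.typeGOrd he).mpr hLow)) hEx

/-- **X3♯(G-ord) ∩ `I₀*`, `r_an = 0`, `p ≡ 1 (mod 4)`: `ChiBranchLowerLeadingTermAt W p` +
`ExactLeadingTermAt W p` ⟹ `Typed.MissingLowerBoundAt W p`.**
[cite: Pal2012, Thm. 3.2] [cite: Delbourgo1998, Prop. 4 (p. 144) (shape of the exact input)] -/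
theorem ClassX3Gord.missingLowerBoundAt_rankZero_of_chiBranchLower_of_exact
    (hPal : Pal2012.thm32_sqrt_mul_realPeriodRat_twist_eq_of_prime_one_mod_four)
    (hGZK : rank_eq_analyticRank_of_analyticRank_le_one) (hmod : hasEntireLFunction_rat)
    (hmodD : nonempty_modularParametrizationData)
    (hX : ClassX3Gord W p) (he : semistabilityIndex W p = 2) (hp4 : p % 4 = 1)
    (hr : W.analyticRank = 0) (hLow : ChiBranchLowerLeadingTermAt W p) (hEx : ExactLeadingTermAt W p) :
    MissingLowerBoundAt W p :=
  ClassX3Gord.missingLowerBoundAt_rankZero_of_cycLeadingTermDvd_of_exact hGZK hmod hX hr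
    (cycLeadingTermDvdAt_of_cycLowerLeadingTermAt W p
      ((cycLowerLeadingTermAt_iff_chiBranchLower_of_typeGOrd_of_semistabilityIndex_eq_two W p hPal
        hmod hmodD hp4 hX.addv hX.typeGOrd he).mpr hLow)) hEx

/-- **X3♯(G-ord) ∩ `I₀*`, `r_an = 0`, `p ≡ 3 (mod 4)`: `ChiBranchLowerLeadingTermOddAt W p` +
`ExactLeadingTermAt W p` ⟹ `Typed.MissingLowerBoundAt W p`.**
[cite: Pal2012, Thm. 3.2] [cite: Delbourgo1998, Prop. 4 (p. 144) (shape of the exact input)] -/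
theorem ClassX3Gord.missingLowerBoundAt_rankZero_of_chiBranchLowerOdd_of_exact
    (hGZK : rank_eq_analyticRank_of_analyticRank_le_one) (hmod : hasEntireLFunction_rat)
    (hmodD : nonempty_modularParametrizationData)
    (hX : ClassX3Gord W p) (he : semistabilityIndex W p = 2) (hp4 : p % 4 = 3)
    (hr : W.analyticRank = 0) (hLow : ChiBranchLowerLeadingTermOddAt W p) (hEx : ExactLeadingTermAt W p) :
    MissingLowerBoundAt W p :=
  ClassX3Gord.missingLowerBoundAt_rankZero_of_cycLeadingTermDvd_of_exact hGZK hmod hX hr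
    (cycLeadingTermDvdAt_of_cycLowerLeadingTermAt W p
      ((cycLowerLeadingTermAt_iff_chiBranchLowerOdd_of_typeGOrd_of_semistabilityIndex_eq_two W p
        hmod hmodD hp4 hX.addv hX.typeGOrd he).mpr hLow)) hEx

/-! ### §2 Non-vacuity of the binder set on the (G)-ordinary defect-2 rows -/

variable (W p)

omit [W.IsGloballyMinimal] in
/-- **NON-VACUITY, `p ≡ 1 (mod 4)`**: on an additive (G)-ordinary pair of defect `2` (`p` odd) the
binder set of `ChiBranchLowerLeadingTermAt W p` / `ChiBranchLowerDivisibilityAt W p` is INHABITED: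
a globally minimal GOOD ORDINARY twist model `V` with `C • V^{(p)} = W`
(`TypeGOrd.exists_goodOrd_model_twist_pStar`), its newform and period ratio `ϖ·Ω_V = Ω⁺_f`
(`hmodD`), a cyclotomic `κ/γ` matching the cyclotomic variable, and a dual datum of `Sel_{p^∞}(W/ℚ_∞)`.
[cite: EdixhovenManin1991, §1] -/
theorem exists_semistableTwistDatum_of_typeGOrd_of_semistabilityIndex_eq_two [W.IsGloballyMinimal]
    (hmodD : nonempty_modularParametrizationData) (hp4 : p % 4 = 1) (hadd : Addv W p)
    (hG : TypeGOrd W p) (he : semistabilityIndex W p = 2) :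
    ∃ (V : WeierstrassCurve ℚ) (_ : V.IsElliptic) (_ : V.IsGloballyMinimal)
      (κ : ZpExtension ℚ p) (γ : Field.absoluteGaloisGroup ℚ) (N : ℕ) (_ : NeZero N)
      (f : CuspForm (Gamma0 N) 2) (_ : W.SelmerDualData κ γ) (ϖ : ℚ),
      (∃ C : VariableChange ℚ, C • V.quadraticTwist (p : ℚ) = W) ∧ GoodOrd V p ∧
        κ.IsCyclotomic ∧ κ.IsTopGenerator γ ∧ IsCyclotomicVariable p γ ∧ IsNewformOf V f ∧
        (ϖ : ℝ) * V.realPeriodRat = plusPeriod f := by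
  have hp2 : p ≠ 2 := by omega
  have hp0 : (p : ℚ) ≠ 0 := by exact_mod_cast hp.out.ne_zero
  obtain ⟨V, iV, iVm, hWV, hord⟩ := TypeGOrd.exists_goodOrd_model_twist_pStar W p hp2 hG hadd he
  rw [pStar_eq_self_of_mod_four_eq_one hp4] at hWV
  have hVW : ∃ C : VariableChange ℚ, C • V.quadraticTwist (p : ℚ) = W :=
    exists_variableChange_quadraticTwist_symm V W hp0 hWV
  haveI : NeZero (V.conductorNorm ℤ) := ⟨(V.conductorNorm_pos_holds).ne'⟩
  obtain ⟨Dm⟩ := hmodD V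
  obtain ⟨ϖ, -, hϖ, -⟩ := Dm.exists_rat_mul_realPeriodRat_eq_plusPeriod
  obtain ⟨κ, hκ, γ, hγ, hγ'⟩ := exists_isCyclotomic_isTopGenerator_isCyclotomicVariable_holds p
  obtain ⟨D⟩ := W.nonempty_selmerDualData_holds κ γ hγ
  exact ⟨V, iV, iVm, κ, γ, _, inferInstance, Dm.f, D, ϖ, hVW, hord, hκ, hγ, hγ', Dm.isNewformOf, hϖ⟩

omit [W.IsGloballyMinimal] in
/-- **NON-VACUITY, `p ≡ 3 (mod 4)`** (`p = 3` included; twist by `−p`, minus period ratio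
`ϖ⁻·|Ω⁻(V)| = Ω⁻_f`): the binder set of `ChiBranchLowerLeadingTermOddAt W p` /
`ChiBranchLowerDivisibilityOddAt W p` is INHABITED on every additive (G)-ordinary defect-2 pair.
[cite: EdixhovenManin1991, §1] -/
theorem exists_semistableTwistDatum_of_typeGOrd_of_semistabilityIndex_eq_two_odd [W.IsGloballyMinimal]
    (hmodD : nonempty_modularParametrizationData) (hp4 : p % 4 = 3) (hadd : Addv W p)
    (hG : TypeGOrd W p) (he : semistabilityIndex W p = 2) :
    ∃ (V : WeierstrassCurve ℚ) (_ : V.IsElliptic) (_ : V.IsGloballyMinimal)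
      (κ : ZpExtension ℚ p) (γ : Field.absoluteGaloisGroup ℚ) (N : ℕ) (_ : NeZero N)
      (f : CuspForm (Gamma0 N) 2) (_ : W.SelmerDualData κ γ) (ϖ : ℚ),
      (∃ C : VariableChange ℚ, C • V.quadraticTwist (-(p : ℚ)) = W) ∧ GoodOrd V p ∧
        κ.IsCyclotomic ∧ κ.IsTopGenerator γ ∧ IsCyclotomicVariable p γ ∧ IsNewformOf V f ∧
        (ϖ : ℝ) * V.imaginaryPeriodRat = minusPeriod f := by
  have hp2 : p ≠ 2 := by omega
  have hp0 : (-(p : ℚ)) ≠ 0 := neg_ne_zero.mpr (by exact_mod_cast hp.out.ne_zero)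
  obtain ⟨V, iV, iVm, hWV, hord⟩ := TypeGOrd.exists_goodOrd_model_twist_pStar W p hp2 hG hadd he
  rw [pStar_eq_neg_of_mod_four_eq_three hp4] at hWV
  have hVW : ∃ C : VariableChange ℚ, C • V.quadraticTwist (-(p : ℚ)) = W :=
    exists_variableChange_quadraticTwist_symm V W hp0 hWV
  haveI : NeZero (V.conductorNorm ℤ) := ⟨(V.conductorNorm_pos_holds).ne'⟩
  obtain ⟨Dm⟩ := hmodD V
  obtain ⟨ϖ, -, hϖ⟩ := exists_rat_mul_imaginaryPeriodRat_eq_minusPeriod Dm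
  obtain ⟨κ, hκ, γ, hγ, hγ'⟩ := exists_isCyclotomic_isTopGenerator_isCyclotomicVariable_holds p
  obtain ⟨D⟩ := W.nonempty_selmerDualData_holds κ γ hγ
  exact ⟨V, iV, iVm, κ, γ, _, inferInstance, Dm.f, D, ϖ, hVW, hord, hκ, hγ, hγ', Dm.isNewformOf, hϖ⟩

end Summit.BirchSwinnertonDyer.Rank1Residual.Additive

end
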